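import Literature.AlgebraicGeometry.ShimuraVarieties.KudlaRapoport2013.Sec13LevelStructures
import Mathlib.NumberTheory.NumberField.Discriminant.Different
import Mathlib.RingTheory.RamificationInertia.Ramification
import HarnessLib

/-!
# [KudlaRapoport2013, §13.1 after Def. 13.2 (arXiv v2 p. 49)] «an `O_k`-module of type `t = 0` is a self-dual hermitian
# `O_k`-module» — DISCHARGED: `KR2013_13_2_typeZero_holds`

Kernel-lane companion of the statement carpet ★
`Literature/AlgebraicGeometry/ShimuraVarieties/KudlaRapoport2013/Sec13LevelStructures.lean`: its CLOSED named fact ★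
`KR2013_13_2_typeZero` — S. Kudla, M. Rapoport, *Special cycles on unitary Shimura varieties II: global theory*, J. reine
angew. Math. 697 (2014) 91–157 = arXiv:0912.3758v2, §13.1 (p. 49), after Definition 13.2 («An `O_k`-module `L` equipped with
a `k`-valued hermitian form of signature `(n−r, r)` is called of type `t` if `L ⊂ L^∨ ⊂ Δ⁻¹L` and
`L^∨/L ≃ ∏_{p∣Δ} 𝔽_p^{t(p)}`»): «In particular, an `O_k`-module of type `t = 0` is a self-dual hermitian `O_k`-module.»,
typed as an `↔` for hermitian full lattices `(J, L) ⊆ kⁿ` — is PROVED here.  THEOREMS ONLY (no definition, no named fact,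
no `sorry`, no instance, no notation); cell hodgecm-mathlib, seat B-typ04 (g31); net debt −1.

## The proof

* (⇒) A type-`0` quotient `L^∨/L ≃ ∏_{p∣Δ} 𝔽_p^0` is trivial, so `L^∨ ⊆ L`; with `L ⊆ L^∨` this is `L = L^∨`.
* (⇐) For `L = L^∨` take `L' = L` (then `L'/L = 0 ≃ ∏ 𝔽_p^0`) and `Δ · L^∨ = Δ · L ⊆ L`.  Definition 13.2 as typed also asks
  for the standing witnesses `𝔭_p`, `𝔭_p² = (p)`, at the primes `p ∣ Δ` (the ramified primes of the imaginary-quadratic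
  field `k`, `𝔽_p = O_k/𝔭_p`); these exist by the Dedekind discriminant theorem (Mathlib
  `NumberField.not_dvd_discr_iff_isUnramifiedIn`: `p ∣ Δ` iff `p` ramifies) and a norm count in the quadratic field:
  a prime `𝔭 ∣ p` with `e ≥ 2` has `𝔭² ∣ (p)`, `N(p) = p²`, `N(𝔭) ≠ 1`, hence `(p) = 𝔭²` (`exists_isPrime_sq_eq_span`).

## References
* [KudlaRapoport2013] S. Kudla, M. Rapoport, *Special cycles on unitary Shimura varieties II: global theory*, J. reine angew.
  Math. 697 (2014) 91–157; arXiv:0912.3758v2, §13.1 Def. 13.2 and the sentence after it (p. 49).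
* [Neukirch1999] J. Neukirch, *Algebraic Number Theory*, Ch. III Thm. 2.6 / Cor. 2.12 (`p` ramifies iff `p ∣ d_k`), Ch. I
  Prop. 8.2 (fundamental identity `Σ eᵢfᵢ = n`) — the classical sources of the ramification step.
-/

set_option autoImplicit false

noncomputable section

open NumberField

namespace Literature.AlgebraicGeometry.ShimuraVarieties.KudlaRapoport2013.Sec13LevelStructures

open Literature.NumberTheory.Automorphic.Liu2021.AppendixC (conj)
open Literature.AlgebraicGeometry.ShimuraVarieties.KudlaRapoport2013.Sec3ComplexUniformization

section Ramified

variable {k : Type} [Field k] [NumberField k]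

/-- **The ramified primes of a quadratic field are squares of primes**: if `[k : ℚ] = 2` and the rational prime `p` divides
`|d_k|`, then `(p) = 𝔭²` for a prime `𝔭` of `O_k`.  From Mathlib's Dedekind discriminant theorem (`p ∣ d_k` iff `p` is
ramified) and norms: a prime `𝔭 ∣ p` with ramification index `≥ 2` gives `(p) = 𝔭² · J` with `N(𝔭)² · N(J) = N(p) = p²`,
`N(𝔭) ≠ 1`, so `N(𝔭) = p`, `N(J) = 1`, `J = O_k`. [cite: Neukirch1999, Ch. III Cor. 2.12 and Ch. I Prop. 8.2] -/
private theorem exists_isPrime_sq_eq_span [Algebra.IsQuadraticExtension ℚ k] {p : ℕ} (hp : p.Prime)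
    (hdvd : p ∣ absDisc k) : ∃ 𝔭 : Ideal (𝓞 k), 𝔭.IsPrime ∧ 𝔭 ^ 2 = Ideal.span {((p : ℤ) : 𝓞 k)} := by
  classical
  have hpZ : Prime (p : ℤ) := Nat.prime_iff_prime_int.mp hp
  have hdvdZ : (p : ℤ) ∣ NumberField.discr k := Int.natCast_dvd.mpr hdvd
  -- a ramified prime `Q` over `p`
  have hnot : ¬ Algebra.IsUnramifiedIn (𝓞 k) (Ideal.span {(p : ℤ)}) := fun h =>
    ((NumberField.not_dvd_discr_iff_isUnramifiedIn k (𝓞 k) hpZ).mpr h) hdvdZ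
  rw [Algebra.isUnramifiedIn_iff_forall_ramificationIdx_eq_one] at hnot
  push Not at hnot
  obtain ⟨Q, hQ, hQover, hQe⟩ := hnot
  haveI := hQ
  haveI := hQover
  set P0 : Ideal ℤ := Ideal.span {(p : ℤ)} with hP0
  have hP0ne : P0 ≠ ⊥ := by
    rw [hP0, Ne, Ideal.span_singleton_eq_bot]
    exact hpZ.ne_zero
  have hmap : P0.map (algebraMap ℤ (𝓞 k)) = Ideal.span {((p : ℤ) : 𝓞 k)} := by
    rw [hP0, Ideal.map_span, Set.image_singleton, eq_intCast]
  -- `e(Q|p) ≥ 2`, so `(p) ≤ Q²`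
  have he' : P0.ramificationIdx' Q = Q.ramificationIdx ℤ := Ideal.ramificationIdx'_eq_ramificationIdx P0 Q hP0ne
  have he0 : P0.ramificationIdx' Q ≠ 0 := Ideal.IsDedekindDomain.ramificationIdx'_ne_zero_of_liesOver Q hP0ne
  have he2 : 2 ≤ P0.ramificationIdx' Q := by
    rw [← he'] at hQe
    omega
  have hle : P0.map (algebraMap ℤ (𝓞 k)) ≤ Q ^ 2 := Ideal.le_pow_of_le_ramificationIdx' he2
  obtain ⟨J, hJ⟩ := Ideal.dvd_iff_le.mpr hle
  -- norms: `N(p) = p²`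
  have hrank : Module.finrank ℤ (𝓞 k) = 2 := by
    rw [NumberField.RingOfIntegers.rank, Algebra.IsQuadraticExtension.finrank_eq_two ℚ k]
  have hnormI : Ideal.absNorm (P0.map (algebraMap ℤ (𝓞 k))) = p ^ 2 := by
    rw [hmap, Ideal.absNorm_span_singleton, ← eq_intCast (algebraMap ℤ (𝓞 k)), Algebra.norm_algebraMap, hrank,
      Int.natAbs_pow, Int.natAbs_natCast]
  have hQ1 : Ideal.absNorm Q ≠ 1 := fun h => hQ.ne_top (Ideal.absNorm_eq_one_iff.mp h)
  rw [hJ, map_mul, map_pow] at hnormI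
  have hdvdp : Ideal.absNorm Q ∣ p := by
    have h2 : Ideal.absNorm Q ^ 2 ∣ p ^ 2 := ⟨Ideal.absNorm J, hnormI.symm⟩
    exact (Nat.pow_dvd_pow_iff two_ne_zero).mp h2
  have hQp : Ideal.absNorm Q = p := ((Nat.dvd_prime hp).mp hdvdp).resolve_left hQ1
  rw [hQp] at hnormI
  have hJ1 : Ideal.absNorm J = 1 := (mul_eq_left₀ (pow_ne_zero 2 hp.ne_zero)).mp hnormI
  have hJtop : J = ⊤ := Ideal.absNorm_eq_one_iff.mp hJ1
  refine ⟨Q, hQ, ?_⟩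
  rw [← hmap, hJ, hJtop, Ideal.mul_top]

end Ramified

/-- ★ `KR2013_13_2_typeZero` HOLDS. [KudlaRapoport2013 §13.1, after Def. 13.2 (arXiv v2 p. 49)]: «In particular, an
`O_k`-module of type `t = 0` is a self-dual hermitian `O_k`-module.» — for a hermitian full lattice `(J, L) ⊆ kⁿ` over the
imaginary-quadratic field `k`, `(J, L)` is of type `t ≡ 0` (Def. 13.2: `L ⊆ L^∨`, `Δ L^∨ ⊆ L`, `L^∨/L ≃ ∏_{p∣Δ} 𝔽_p^0`, with
the ramified primes `𝔭_p² = (p)`) iff `L = L^∨`.  (⇒): the quotient is trivial; (⇐): `L' = L`, and the `𝔭_p` exist by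
`exists_isPrime_sq_eq_span`. [cite: KudlaRapoport2013, §13.1 Def. 13.2 (arXiv v2 p. 49)] -/
theorem KR2013_13_2_typeZero_holds : KR2013_13_2_typeZero := by
  intro k _ _ _ _ n X hJ hL
  classical
  constructor
  · rintro ⟨hsub, -, L', 𝔭, hL', -, ⟨e⟩⟩ x
    refine ⟨fun hx => hsub x hx, fun hx => ?_⟩
    have hxL' : x ∈ L' := by
      rw [← SetLike.mem_coe, hL']
      exact hx
    have hss : Subsingleton (L' ⧸ X.L.comap L'.subtype) := e.toEquiv.subsingleton
    have htop : X.L.comap L'.subtype = ⊤ := (Submodule.Quotient.subsingleton_iff (p := _)).mp hss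
    have hmem : (⟨x, hxL'⟩ : L') ∈ X.L.comap L'.subtype := by
      rw [htop]
      exact Submodule.mem_top
    simpa using hmem
  · intro hsd
    have hdual : ∀ x, x ∈ dualSet (conj ℚ k : k →+* k) X.J X.L ↔ x ∈ X.L := fun x => (hsd x).symm
    refine ⟨fun x hx => (hdual x).mpr hx, fun x hx => ?_, X.L,
      fun p => if h : p.Prime ∧ p ∣ absDisc k then (exists_isPrime_sq_eq_span (k := k) h.1 h.2).choose else ⊥,
      Set.ext fun x => ?_, fun p hp => ?_, ?_⟩
    · -- `Δ · L^∨ ⊆ L`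
      have hxL : x ∈ X.L := (hdual x).mp hx
      have hsmul : ((absDisc k : ℚ) : k) • x = ((absDisc k : ℕ) : 𝓞 k) • x := by
        rw [Rat.cast_natCast, ← map_natCast (algebraMap (𝓞 k) k), algebraMap_smul]
      rw [hsmul]
      exact X.L.smul_mem _ hxL
    · -- `L' = L^∨` as sets
      rw [SetLike.mem_coe]
      exact (hdual x).symm
    · -- the ramified primes
      obtain ⟨hpp, hpd, -⟩ := Nat.mem_primeFactors.mp hp
      have h' : p.Prime ∧ p ∣ absDisc k := ⟨hpp, hpd⟩
      simp only [dif_pos h']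
      exact (exists_isPrime_sq_eq_span (k := k) h'.1 h'.2).choose_spec
    · -- `L/L = 0 ≃ ∏ 𝔽_p^0`
      haveI : Subsingleton (X.L ⧸ X.L.comap X.L.subtype) :=
        (Submodule.Quotient.subsingleton_iff (p := _)).mpr (Submodule.comap_subtype_self X.L)
      exact ⟨LinearEquiv.ofSubsingleton _ _⟩

end Literature.AlgebraicGeometry.ShimuraVarieties.KudlaRapoport2013.Sec13LevelStructures
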